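import Literature.NumberTheory.EllipticCurves.SigmaEulerData
import HarnessLib

/-!
# Discharge of the local `Σ`-atom, module L3: the TOTALLY SPLIT case's plumbing —
# an Euler datum `(Nw, t, c)` at `w ∤ p` has `c = c_w` (the Frobenius exponent), and `c = 0` forces
# `κ ∘ res_w = 1` on the whole decomposition group and excludes the split multiplicative type

THEOREMS ONLY (no definition, no named fact, no `sorry`). Cell `bsd-stepL` (K2 support 20427), seat
`bsd-stepL-imc-p1` (prover g12, 2026-08-27). Part L3 of the discharge plan for the named fact
`JetchevSkinnerWan2017.sigmaLocal_charIdeal_eulerFactor_mem_of_noTamagawaDefect` (p543519; plan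
`HOME/defn-ty1/g9/NOTE-sigmaLocal-discharge-plan-defn-ty1-g9.md`: L1/L2 generic = defn-ty1 g9, L3–L6 = imc-p1):
in the fact's binder `IsEulerDataAt W κ w Nw t c` the exponent `c` is ANY `κ(φ)` for an arithmetic Frobenius
`φ` at `w`; at `w ∤ p` it equals the tree's `ZpExtension.frobExponentAt κ w` (`κ` kills inertia,
`apply_localMap_inl_eq_frobExponentAt`), so `c = 0` puts the decomposition group `D_w` inside `ker κ`
(`decomp_le_kerSubgroup_of_frobExponentAt_eq_zero`: `w` is totally split in `K_∞`), i.e. the big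
representation restricted to `Γ_{K_w}` has TRIVIAL twist — the hypothesis of L2 (`H¹(D, bigRep κ ρ) ≃
BigRepModule (H¹(D, A))` for `κ|_D = 1`); and `NoTamagawaDefect p t 0` excludes `t = splitMult` (and
`additive` when `p = 3`).

* `IsEulerDataAt.eq_frobExponentAt` — `c = c_w`;
* `IsEulerDataAt.apply_localMap_inl_eq_one` — `c = 0 ⇒ κ (res_w σ) = 1` for every `σ ∈ Γ_{K_w}`;
* `IsEulerDataAt.absNorm_eq`, `NoTamagawaDefect.ne_splitMult`, `NoTamagawaDefect.ne_additive` — unpackings.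

References: [Washington1997] Prop. 13.2 (`ℤ_p`-extensions unramified outside `p`); [TateCorvallis1979] §1.4
(1.4.1); [Brink2007] Thm. 2; [JetchevSkinnerWan2017] §5.1 (Remark: `Ψ(Frob_w) = 1` at inert `w`);
[PollackWeston2011] Lemma 3.2 ("`ℓ` splits completely in `K_∞`").
-/

noncomputable section

open NumberField IsDedekindDomain Field
open Literature.NumberTheory.EllipticCurves Literature.NumberTheory.EllipticCurves.BigGaloisRep
  Literature.NumberTheory.EllipticCurves.IwasawaCharacter Literature.NumberTheory.GaloisRepresentations

namespace Literature.NumberTheory.EllipticCurves.JetchevSkinnerWan2017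

variable {K : Type} [Field K] [NumberField K] {p : ℕ} [Fact p.Prime]
variable {W : WeierstrassCurve K} {κ : ZpExtension K p} {w : HeightOneSpectrum (𝓞 K)}
  {Nw : ℕ} {t : LocalReductionData} {c : ℤ_[p]}

/-- The norm clause of an Euler datum: `Nw = N(w)`. [cite: JetchevSkinnerWan2017, §5.1 (the Euler factors `P_w(ε⁻¹Ψ⁻¹(Frob_w))`, `ε(Frob_w) = N(w)`)] -/
theorem IsEulerDataAt.absNorm_eq (h : IsEulerDataAt W κ w Nw t c) : Nw = Ideal.absNorm w.asIdeal :=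
  h.1

/-- **The Frobenius exponent of an Euler datum at `w ∤ p` is the tree's `c_w`**: the datum records
`κ(φ) = c` for SOME arithmetic Frobenius `φ` at `w`, and at `w ∤ p` all arithmetic Frobenii have the same
image `c_w = ZpExtension.frobExponentAt κ w` (a `ℤ_p`-extension is unramified outside `p`).
[cite: Washington1997, Prop. 13.2] [cite: TateCorvallis1979, §1.4 (1.4.1)] -/
theorem IsEulerDataAt.eq_frobExponentAt (h : IsEulerDataAt W κ w Nw t c)
    (hw : ((p : ℕ) : 𝓞 K) ∉ w.asIdeal) : c = κ.frobExponentAt w := by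
  obtain ⟨φ, hφ, hκφ⟩ := h.2.1
  rw [κ.apply_localMap_inl_eq_frobExponentAt hw hφ] at hκφ
  exact (Multiplicative.ofAdd.injective hκφ).symm

/-- **A totally split Euler datum (`c = 0`) at `w ∤ p`: `κ` is trivial on the whole decomposition group**,
`κ (res_w σ) = 1` for every `σ ∈ Γ_{K_w}` — the big representation `T ⊗ Λ^*(Ψ⁻¹)` restricted to `Γ_{K_w}`
has trivial twist ("`Ψ(Frob_w) = 1`"; "`ℓ` splits completely in `K_∞`"). From `c = c_w = 0` and the tree's
`ZpExtension.decomp_le_kerSubgroup_of_frobExponentAt_eq_zero`.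
[cite: JetchevSkinnerWan2017, §5.1 (Remark on inert places: "`Ψ(Frob_w) = 1`")]
[cite: PollackWeston2011, Lemma 3.2 (arXiv:math/0610694 p. 7, "`ℓ` splits completely in `K_∞`")] -/
theorem IsEulerDataAt.apply_localMap_inl_eq_one (h : IsEulerDataAt W κ w Nw t c)
    (hw : ((p : ℕ) : 𝓞 K) ∉ w.asIdeal) (hc : c = 0)
    (σ : absoluteGaloisGroup (w.adicCompletion K)) : κ (localMap K (Sum.inl w) σ) = 1 := by
  have h0 : κ.frobExponentAt w = 0 := (h.eq_frobExponentAt hw).symm.trans hc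
  have hmem : localMap K (Sum.inl w) σ ∈ GreenbergSelmer.decomp w := by
    rw [← range_localMap_inl]
    exact ⟨σ, rfl⟩
  exact ZpExtension.mem_kerSubgroup.1 (κ.decomp_le_kerSubgroup_of_frobExponentAt_eq_zero hw h0 hmem)

/-- The same in `toAdd` form: `(κ (res_w σ)).toAdd = 0`. [cite: JetchevSkinnerWan2017, §5.1 (Remark on inert places)] -/
theorem IsEulerDataAt.toAdd_apply_localMap_inl_eq_zero (h : IsEulerDataAt W κ w Nw t c)
    (hw : ((p : ℕ) : 𝓞 K) ∉ w.asIdeal) (hc : c = 0)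
    (σ : absoluteGaloisGroup (w.adicCompletion K)) : (κ (localMap K (Sum.inl w) σ)).toAdd = 0 := by
  rw [h.apply_localMap_inl_eq_one hw hc σ, toAdd_one]

/-- No Tamagawa defect at a totally split datum excludes the split multiplicative type.
[cite: Castella2018, Prop. 2.5 and its proof (arXiv:1704.06608 p. 7, `t_E(w) = ord_p(c_w(E/K))`)] -/
theorem NoTamagawaDefect.ne_splitMult (hB : NoTamagawaDefect p t c) (hc : c = 0) :
    t ≠ LocalReductionData.splitMult :=
  (hB hc).1

/-- No Tamagawa defect at a totally split datum excludes the additive type when `p = 3`.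
[cite: Castella2018, Prop. 2.5 and its proof (arXiv:1704.06608 p. 7)] -/
theorem NoTamagawaDefect.ne_additive (hB : NoTamagawaDefect p t c) (hc : c = 0) (hp : p = 3) :
    t ≠ LocalReductionData.additive :=
  (hB hc).2 hp

end Literature.NumberTheory.EllipticCurves.JetchevSkinnerWan2017

end
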